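import Summits.ABC.ABC.Theorems.StewartTijdeman1986Holds
import HarnessLib

/-!
# `log c ≤ κ · rad(abc)^6` from the ODD-prime `p`-adic socket alone

`Summits/ABC/ABC/Theorems/BakerShapeBoundSixOddSocket.lean` — papers lane ABC-P1 (writer seat
`papers-abcp1-w1`), a corollary file next to the rung file `StewartTijdeman1986Holds.lean` of cell
`abc-stewartyu`; theorems only (no definition, no named fact).

The route `PadicPrincipalCoreST86` closes the Stewart–Tijdeman 1986 leaf `BakerShapeBound 15 0`
(`log c ≤ κ · rad^{15}`) by composing Theorem A (cap `c₂ ≤ 10`), WP-M, the glue (`κ ≤ c₂ + 2`, `σ = 2`)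
and the odd-prime socket (any `θ ≥ κ + σ + 1`); the exponent `15` is the printed target, not the limit
of the argument.  With the PROVED cap `c₂ ≤ 1` of Theorem A
(`Summit.ABC.StewartYu.theoremAShapeLe_one_holds : TheoremAShapeLe 1`, the proof term of item
stmt-ABC-19165 `TheoremAOne`, declared in `PadicPrincipalCoreST86TheoremA.lean`) the same
composition — verbatim the proof of `Summit.ABC.ABC.Theses.PadicPrincipalCoreST86.closes` with
`θ = 6 = 3 + 2 + 1` — gives `BakerShapeBound 6 0`.  This file imports only the `R^{15}` rung file
(`StewartTijdeman1986Holds`): no archimedean and no `2`-adic linear-forms module is in its import cone (the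
socket `OddShapeSpec` quantifies over odd primes only and treats even `c` by `b ∣ c² − a²`, `c < 2b`).
A weaker statement than the tree's Stewart–Yu 1991 theorem (`stewartYu1991_holds`, which gives every
exponent `> 2/3`), recorded for the bookkeeping of which inputs each exponent needs.
-/

set_option linter.dupNamespace false

namespace Summit.ABC.ABC.Theorems

/-- **`log c ≤ κ · rad(abc)^6` for all abc triples, from `p`-adic estimates at the odd primes only**:
`Literature.Barriers.ABC.BakerShapeBound 6 0`, by Theorem A with the envelope `C(m) ≤ (2^70)^m · m^m`
(`c₂ = 1`), WP-M, the glue (`κ ≤ 3`, `σ = 2`) and the odd socket at `θ = 6`. [folklore] assembly of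
landed theorems; compare [cite: StewartTijdeman1986, Theorem 1 (upper bound), as quoted in
Waldschmidt2014 §2] (`θ = 15`). -/
theorem bakerShapeBound_six_zero_oddSocket : Literature.Barriers.ABC.BakerShapeBound 6 0 := by
  obtain ⟨C, r, c₁, c₂, hc₁, hc₂, hc₂1, hC, hB⟩ := Summit.ABC.StewartYu.theoremAShapeLe_one_holds
  obtain ⟨K, L, κ, hK, hL, hκ0, hκ, h⟩ :=
    padicPrincipalCoreST86_glueSpec_proof
      Summit.ABC.StewartYu.PrincipalLattice.exists_principal_generators C r c₁ c₂ hc₁ hc₂ hC hB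
  exact padicPrincipalCoreST86_oddShapeSpec_proof K L κ 2 6 2 2 hK hL hκ0 (by norm_num) (by linarith) h

end Summit.ABC.ABC.Theorems
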